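import Summits.Ventures.PackingBounds.ThreePointCert.SoundNN
import Summits.Ventures.PackingBounds.ThreePointCert.CheckKSP
import Summits.Ventures.PackingBounds.ThreePointCert.CheckFKSSound
import Summits.Ventures.PackingBounds.ThreePointCert.CheckIdKSSound
import Summits.Ventures.PackingBounds.ThreePointCert.K21d14ExpandKS1
import Summits.Ventures.PackingBounds.ThreePointCert.K21d14ExpandKS2
import Summits.Ventures.PackingBounds.ThreePointCert.K21d14ExpandKS3
import Summits.Ventures.PackingBounds.ThreePointCert.K21d14ExpandKS4
import Summits.Ventures.PackingBounds.ThreePointCert.K21d14ExpandKS5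
import Summits.Ventures.PackingBounds.ThreePointCert.K21d14ExpandKS6
import Summits.Ventures.PackingBounds.ThreePointCert.K21d14ExpandKS7
import Summits.Ventures.PackingBounds.ThreePointCert.K21d14ExpandKS8
import Summits.Ventures.PackingBounds.ThreePointCert.K21d14ExpandKS9
import Summits.Ventures.PackingBounds.ThreePointCert.K21d14ExpandF
import Summits.Ventures.PackingBounds.ThreePointCert.K21d14CheckId

/-!
# κ(21) ≤ 54565: the kernel-checked theorem

Framing: lottery ticket; floor = certified bounds/negative ranges. Venture `PackingBounds` (cell
`pub-packcert`), three-point SDP family, kissing column. Integer data / kernel checks of a feasible point of the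
Bachoc–Vallentin semidefinite program (n = 21, s = 1/2, three-point matrix degree 14, two-point (Gegenbauer) part to
degree L = 28, Bachoc–Vallentin multiplier set = cell mode sym2; exact rational certificate `sdp-n21-d14-s1-2-sym2-a28-hyb8dd-j155363.json`
(sha256 c40a3cacdaec0389e4e1168429c848a3b3e156f0521ec0d41836b5b35ab5d0c3) of the sdp seat's hybrid pipeline, verified by the cell's two exact verifiers), converted by
`cert2lean_g9.py` (lp gen 9; S = 90) into the units of the kernel checker `ThreePointCert.Check` + `CheckSym2` with the
record degree field set to L = 28 (the checker's degree enters only the unit `W = 2^d·d!` and the side conditions, so a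
(d, L) certificate is a `Cert3` of degree L); symmetry-adapted PARTS (S₃/S₂ isotypic bases of short polynomials) with coarse factor COLUMNS, validated by
Kronecker substitution `ThreePointCert.CheckKSP` (`sosCheckKSParts`: the claimed expansion and `Σ_parts Σ_k col_k²` compared at `(2^w, 2^{wD}, 2^{wD²})`); three-point part by `CheckFKS`;
split check of (ii') `ThreePointCert.CheckSym2Split`. Emitter `emitlean_ks3.py` (lp gen 10; expansions `4^k • Σ_parts pᵀ(L′L′ᵀ)p` lifted by `SoundNN.boxNonneg_smul`). Generated file: plain lists of integers / monomials.
-/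

namespace Summit.Ventures.PackingBounds.ThreePointCert.K21d14

open Literature.Geometry.DiscreteGeometry Literature.Geometry.DiscreteGeometry.PolyCert PolyCert.SPoly

set_option maxRecDepth 100000 in
/-- The expansion data are valid in the weak sense of `SoundNN.PolysNN3` (Gram expansions by `CheckKSP.boxNonneg_of_sosCheckKSParts` over the symmetry-adapted parts, scaled by `boxNonneg_smul`; `FI` by `CheckFKS.fexpValidG_of_fCheckKS`). -/
theorem polys_nn : PolysNN3 K21d14.cert K21d14.polys where
  hF := fexpValidG_of_fCheckKS _ _ cert eFP vF
  h0 := boxNonneg_smul cR0 eR0s (boxNonneg_append _ _ (boxNonneg_append _ _ (boxNonneg_append _ _ (boxNonneg_of_sosCheckKSParts _ _ _ _ _ vR0ptrv) (boxNonneg_of_sosCheckKSParts _ _ _ _ _ vR0palt)) (boxNonneg_append _ _ (boxNonneg_append _ _ (boxNonneg_of_sosCheckKSParts _ _ _ _ _ vR0pstdAg1) (boxNonneg_of_sosCheckKSParts _ _ _ _ _ vR0pstdAg2)) (boxNonneg_of_sosCheckKSParts _ _ _ _ _ vR0pstdAg3))) (boxNonneg_append _ _ (boxNonneg_append _ _ (boxNonneg_of_sosCheckKSParts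 _ _ _ _ _ vR0pstdBg1) (boxNonneg_of_sosCheckKSParts _ _ _ _ _ vR0pstdBg2)) (boxNonneg_of_sosCheckKSParts _ _ _ _ _ vR0pstdBg3)))
  h1 := boxNonneg_smul cR1 eR1s (boxNonneg_append _ _ (boxNonneg_append _ _ (boxNonneg_append _ _ (boxNonneg_append _ _ (boxNonneg_of_sosCheckKSParts _ _ _ _ _ vR1psymg1) (boxNonneg_of_sosCheckKSParts _ _ _ _ _ vR1psymg2)) (boxNonneg_of_sosCheckKSParts _ _ _ _ _ vR1psymg3)) (boxNonneg_of_sosCheckKSParts _ _ _ _ _ vR1psymg4)) (boxNonneg_append _ _ (boxNonneg_append _ _ (boxNonneg_of_sosCheckKSParts _ _ _ _ _ vR1pantig1) (boxNonneg_of_sosCheckKSParts _ _ _ _ _ vR1pantig2)) (boxNonneg_of_sosCheckKSParts _ _ _ _ _ vR1pantig3)))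
  h2 := boxNonneg_smul cR2 eR2s (boxNonneg_of_sosCheckKSParts _ _ _ _ _ vR2)
  h3 := boxNonneg_smul cR3 eR3s (boxNonneg_of_sosCheckKSParts _ _ _ _ _ vR3)
  h4 := boxNonneg_smul cR4 eR4s (boxNonneg_of_sosCheckKSParts _ _ _ _ _ vR4)
  hq0 := boxNonneg_smul cQ0 eQ0s (boxNonneg_of_sosCheckKSParts _ _ _ _ _ vQ0)
  hq1 := boxNonneg_smul cQ1 eQ1s (boxNonneg_of_sosCheckKSParts _ _ _ _ _ vQ1)

set_option maxHeartbeats 0 in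
/-- The side conditions hold. -/
theorem cert_side : checkSide3 K21d14.cert = true := by decide +kernel

set_option maxHeartbeats 0 in
/-- The numerical bound is `< N + 1` (and `≥ 0`). -/
theorem cert_bound : checkBound3 K21d14.cert K21d14.polys = true := by decide +kernel

/-- **κ(21) ≤ 54565**: every finite set of unit vectors of `ℝ^21` with pairwise inner products
`≤ 1 / 2` has at most `54565` elements (kissing configurations of `ℝ^21`) — the Bachoc–Vallentin three-point (semidefinite
programming) bound with their original multiplier set, three-point matrix degree 14 with the two-point (Gegenbauer)
part to degree 28 (the sdp seat's hybrid pipeline, cell family hyb8dd), from the exact certificate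
`sdp-n21-d14-s1-2-sym2-a28-hyb8dd-j155363.json` (bound value 54565.726948), kernel-checked (record degree field `d := 28`; symmetry-adapted parts with coarse Gram factors lifted by `SoundNN`; Gram expansions by Kronecker substitution `CheckKSP`, three-point part by `CheckFKS`, identities (i')/(ii') by `CheckIdKS`).
[cite: BachocVallentin2007, Theorem 4.2] -/
theorem kissing_dim21_le_54565_sdp (C : Finset (EuclideanSpace ℝ (Fin 21)))
    (h1 : ∀ x ∈ C, ‖x‖ = 1) (h2 : ∀ x ∈ C, ∀ y ∈ C, x ≠ y → inner ℝ x y ≤ 1 / 2) :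
    C.card ≤ 54565 :=
  card_le_of_cert3KS _ _ _ _ cert polys polys_nn rhoI rhoII cert_idI cert_idII cert_side cert_bound C h1
    (fun x hx y hy hxy => by
      have h := h2 x hx y hy hxy
      have e : ((cert.p : ℤ) : ℝ) / (cert.q : ℕ) = 1 / 2 := by norm_num [cert]
      rw [e]; exact h)

end Summit.Ventures.PackingBounds.ThreePointCert.K21d14
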